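import Summits.QuantumAdvantage.QuantumAdvantage.Theorems.OddPrimeWalkSignatureBalance
import Summits.QuantumAdvantage.QuantumAdvantage.Theorems.OddPrimeWalkCounterGadget

/-!
# Item stmt-QuantumAdvantage-24150 `FewFormsPairLaw` — the FEW-FORMS PAIR LAW of the u-walk game (route OddPrimeWalk, support, rank 9)

Cell qa-qnc0; planner qa-qnc0-p2 g30 (ROUND-30 §3.9, THM 30-E, brief P2-30f); prover qn-prover-3 g19.

THEOREM (`oddPrimeWalk_fewFormsPairLaw`).  There are absolute `θ < 1`, `K`, `m₀` (here `θ = 143/144`, `K = m₀ = 480`) such that: at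
one separator `m` with `m₀ ≤ m`, `m + m₀ ≤ n`, `s·K ≤ m`, `m + s·K ≤ n`, if every cut at a position `g ≤ m` is
`f_g(v) ⊕ [φ_g · x ∈ R_g(v)]` with `φ_g ∈ {0} ∪ {β_k : k < s}` (`v` = bits `< m`, `x` = bits `≥ m`, `f_g` and the residue SET `R_g`
arbitrary functions of the own side) and every cut at `g > m` is `f_g(x) ⊕ [φ_g · v ∈ R_g(x)]` with `φ_g ∈ {0} ∪ {α_k}`, then
`#WIN ≤ θ·2ⁿ`.  `s = 0` is item 23990 `BlindPairLaw`.

PROOF (the prover's simplification of ROUND-30 §3.9: no ground block, no randomised gadget).  §1: a cut of the filed shape is a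
function of its own half and of the mod-`5` SIGNATURE of the other half (`sigB β m` / `sigA α m`), so the CLASS-BLIND PAIR LAW
`classBlind_mul_le_card_lose` (file `OddPrimeWalkClassBlind`: the planner's `configParity` on one-point-per-cell systems + an injective
double count) gives `balA · balB ≤ 9·#LOSE` with `bal = Σ_σ min_a #cell(σ, a)`.  §2: by the two-moduli bound
(`balanceA_ge_quarter` / `balanceB_ge_quarter`, file `OddPrimeWalkSignatureBalance`, resting on the tree's
`TwoModuli.abs_three_mul_card_cell_sub_card_le`) each balance is `≥ 2^side/4` once the side has `≥ 240(s+1)` bits, which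
`K = m₀ = 480` guarantees; hence `#LOSE ≥ 2ⁿ/144`.
This module is THESES-FREE (the closer is typed against the item's literal signature).
WHAT THIS IS NOT: instrument — a bankable rung strictly above `BlindPairLaw` (≤ m/480 cross forms per side, own-adaptive residue sets);
the dense cruxes 23029/23109 and (WALK-MOD′) are not touched; constants not optimised; separation NOT moved.
-/

namespace Summit.QuantumAdvantage.AdviceFreeQNC0.OddConfig

open Finset Classical

variable {n : ℕ}

/-! ### §1 From the filed hypotheses to class-blindness -/

/-- a cross sum over the far bits of a glued input only sees the second argument. -/
theorem crossB_glue (m : ℕ) (φ : Fin n → ZMod 5) (s t : Fin n → Bool) :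
    (∑ i : Fin n, if m ≤ i.val ∧ glue m s t i = true then φ i else 0)
      = ∑ i : Fin n, if m ≤ i.val ∧ t i = true then φ i else 0 := by
  refine sum_congr rfl fun i _ => ?_
  by_cases hi : m ≤ i.val
  · rw [glue_apply_not_lt _ _ (not_lt.mpr hi)]
  · simp [hi]

/-- a cross sum over the near bits of a glued input only sees the first argument. -/
theorem crossA_glue (m : ℕ) (φ : Fin n → ZMod 5) (s t : Fin n → Bool) :
    (∑ i : Fin n, if i.val < m ∧ glue m s t i = true then φ i else 0)
      = ∑ i : Fin n, if i.val < m ∧ s i = true then φ i else 0 := by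
  refine sum_congr rfl fun i _ => ?_
  by_cases hi : i.val < m
  · rw [glue_apply_lt _ _ hi]
  · simp [hi]

/-- **the filed hypothesis for the cuts `g ≤ m` ⇒ such cuts see Bob's half only through its signature `sigB β m`.** -/
theorem hA_of_fewForms {s : ℕ} (m : ℕ) (y : Fin (n + 1) → (Fin n → Bool) → Bool) (β : Fin s → Fin n → ZMod 5)
    (hyp : ∀ g : Fin (n + 1), g.val ≤ m →
      ∃ f : (Fin n → Bool) → Bool, ∃ R : (Fin n → Bool) → Finset (ZMod 5), ∃ φ : Fin n → ZMod 5,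
        (φ = 0 ∨ ∃ k, φ = β k) ∧ ∀ u : Fin n → Bool,
          y g u = Bool.xor (f (fun i => decide (i.val < m) && u i))
            (decide ((∑ i : Fin n, if m ≤ i.val ∧ u i = true then φ i else 0) ∈
              R (fun i => decide (i.val < m) && u i)))) :
    ∀ g : Fin (n + 1), g.val ≤ m → ∀ s' t t' : Fin n → Bool, sigB β m t = sigB β m t' →
      y g (glue m s' t) = y g (glue m s' t') := by
  intro g hg s' t t' hst
  obtain ⟨f, R, φ, hφ, hy⟩ := hyp g hg
  rw [hy, hy, own_lt_glue, own_lt_glue, crossB_glue, crossB_glue]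
  rcases hφ with rfl | ⟨k, rfl⟩
  · simp
  · have hk := congrFun hst k
    simp only [sigB] at hk
    rw [hk]

/-- **the filed hypothesis for the cuts `g > m` ⇒ such cuts see Alice's half only through its signature `sigA α m`.** -/
theorem hB_of_fewForms {s : ℕ} (m : ℕ) (y : Fin (n + 1) → (Fin n → Bool) → Bool) (α : Fin s → Fin n → ZMod 5)
    (hyp : ∀ g : Fin (n + 1), m < g.val →
      ∃ f : (Fin n → Bool) → Bool, ∃ R : (Fin n → Bool) → Finset (ZMod 5), ∃ φ : Fin n → ZMod 5,
        (φ = 0 ∨ ∃ k, φ = α k) ∧ ∀ u : Fin n → Bool,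
          y g u = Bool.xor (f (fun i => decide (m ≤ i.val) && u i))
            (decide ((∑ i : Fin n, if i.val < m ∧ u i = true then φ i else 0) ∈
              R (fun i => decide (m ≤ i.val) && u i)))) :
    ∀ g : Fin (n + 1), m < g.val → ∀ s' s'' t : Fin n → Bool, sigA α m s' = sigA α m s'' →
      y g (glue m s' t) = y g (glue m s'' t) := by
  intro g hg s' s'' t hss
  obtain ⟨f, R, φ, hφ, hy⟩ := hyp g hg
  rw [hy, hy, own_ge_glue, own_ge_glue, crossA_glue, crossA_glue]
  rcases hφ with rfl | ⟨k, rfl⟩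
  · simp
  · have hk := congrFun hss k
    simp only [sigA] at hk
    rw [hk]

/-! ### §2 The few-forms pair law -/

/-- `480 ≤ L` and `480·s ≤ L` give the `240(s+1)` bits the balance bound needs. -/
theorem bits_of_constants {s L : ℕ} (h0 : 480 ≤ L) (hs : s * 480 ≤ L) : 240 * (s + 1) ≤ L := by
  omega

/-- **FEW-FORMS PAIR LAW** (item stmt-QuantumAdvantage-24150, engine form): `θ = 143/144`, `K = m₀ = 480`. -/
theorem fewFormsPairLaw_card : ∃ θ : ℝ, θ < 1 ∧ ∃ K m₀ : ℕ, ∀ n m c s : ℕ,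
    ∀ y : Fin (n + 1) → (Fin n → Bool) → Bool,
    m₀ ≤ m → m + m₀ ≤ n → s * K ≤ m → m + s * K ≤ n →
    ∀ α β : Fin s → Fin n → ZMod 5,
    (∀ g : Fin (n + 1), g.val ≤ m →
      ∃ f : (Fin n → Bool) → Bool, ∃ R : (Fin n → Bool) → Finset (ZMod 5), ∃ φ : Fin n → ZMod 5,
        (φ = 0 ∨ ∃ k, φ = β k) ∧ ∀ u : Fin n → Bool,
          y g u = Bool.xor (f (fun i => decide (i.val < m) && u i))
            (decide ((∑ i : Fin n, if m ≤ i.val ∧ u i = true then φ i else 0) ∈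
              R (fun i => decide (i.val < m) && u i)))) →
    (∀ g : Fin (n + 1), m < g.val →
      ∃ f : (Fin n → Bool) → Bool, ∃ R : (Fin n → Bool) → Finset (ZMod 5), ∃ φ : Fin n → ZMod 5,
        (φ = 0 ∨ ∃ k, φ = α k) ∧ ∀ u : Fin n → Bool,
          y g u = Bool.xor (f (fun i => decide (m ≤ i.val) && u i))
            (decide ((∑ i : Fin n, if i.val < m ∧ u i = true then φ i else 0) ∈
              R (fun i => decide (m ≤ i.val) && u i)))) →
    ((univ.filter fun u : Fin n → Bool =>
        Summit.QuantumAdvantage.AdviceFreeQNC0.ringWinU c y u = true).card : ℝ) ≤ θ * (2 : ℝ) ^ n := by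
  refine ⟨1 - 1 / 144, by norm_num, 480, 480, ?_⟩
  intro n m c s y hm0 hmn hsK hsKn α β hypA hypB
  have hm : m ≤ n := by omega
  have hLA : 240 * (s + 1) ≤ m := bits_of_constants hm0 hsK
  have hLB : 240 * (s + 1) ≤ n - m := bits_of_constants (by omega) (by omega)
  have hA := hA_of_fewForms m y β hypA
  have hB := hB_of_fewForms m y α hypB
  have hmain := classBlind_mul_le_card_lose m c y (sigA α m) (sigB β m) hA hB
  have hbalA := balanceA_ge_quarter (n := n) hm hLA α
  have hbalB := balanceB_ge_quarter (n := n) hm hLB β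
  have hmainR : ((∑ σ : Fin s → ZMod 5, minCellA m (sigA α m) σ : ℕ) : ℝ) *
      ((∑ σ : Fin s → ZMod 5, minCellB m (sigB β m) σ : ℕ) : ℝ)
        ≤ 9 * ((univ.filter fun u : Fin n → Bool => ¬ ringWinU c y u = true).card : ℝ) := by
    exact_mod_cast hmain
  have hprod : (2 : ℝ) ^ m / 4 * ((2 : ℝ) ^ (n - m) / 4)
      ≤ 9 * ((univ.filter fun u : Fin n → Bool => ¬ ringWinU c y u = true).card : ℝ) :=
    le_trans (mul_le_mul hbalA hbalB (by positivity) (Nat.cast_nonneg _)) hmainR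
  have hpow : (2 : ℝ) ^ m * (2 : ℝ) ^ (n - m) = (2 : ℝ) ^ n := by
    rw [← pow_add]; congr 1; omega
  have htot : ((univ.filter fun u : Fin n → Bool => ringWinU c y u = true).card : ℝ)
      + ((univ.filter fun u : Fin n → Bool => ¬ ringWinU c y u = true).card : ℝ) = (2 : ℝ) ^ n := by
    have h := card_filter_add_card_filter_not (s := (univ : Finset (Fin n → Bool)))
      (fun u : Fin n → Bool => ringWinU c y u = true)
    rw [card_univ, Fintype.card_fun, Fintype.card_bool, Fintype.card_fin] at h
    exact_mod_cast h
  have hlose : (2 : ℝ) ^ n / 144 ≤ ((univ.filter fun u : Fin n → Bool => ¬ ringWinU c y u = true).card : ℝ) := by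
    have e : (2 : ℝ) ^ m / 4 * ((2 : ℝ) ^ (n - m) / 4) = (2 : ℝ) ^ n / 16 := by rw [← hpow]; ring
    rw [e] at hprod
    linarith
  have : ((univ.filter fun u : Fin n → Bool => ringWinU c y u = true).card : ℝ)
      ≤ (2 : ℝ) ^ n - (2 : ℝ) ^ n / 144 := by linarith
  linarith [this]

end Summit.QuantumAdvantage.AdviceFreeQNC0.OddConfig

namespace Summit.QuantumAdvantage.QuantumAdvantage.Theorems

set_option linter.dupNamespace false

/-- **Item stmt-QuantumAdvantage-24150 `FewFormsPairLaw` (route OddPrimeWalk, support, rank 9; planner qa-qnc0-p2 g30 ROUND-30 §3.9,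
THM 30-E; prover qn-prover-3 g19).**  Absolute `θ < 1`, `K`, `m₀`: at one separator `m` (`m₀ ≤ m`, `m + m₀ ≤ n`, `s·K ≤ m`,
`m + s·K ≤ n`), if every cut at `g ≤ m` is (own-side function) ⊕ [a cross form from `{0} ∪ {β_k}` of the bits `≥ m` lies in an
own-side residue set] and symmetrically at `g > m` with `{0} ∪ {α_k}`, then `#WIN ≤ θ·2ⁿ`. -/
theorem oddPrimeWalk_fewFormsPairLaw :
    ∃ θ : ℝ, θ < 1 ∧ ∃ K m₀ : ℕ, ∀ n m c s : ℕ, ∀ y : Fin (n + 1) → (Fin n → Bool) → Bool, m₀ ≤ m → m + m₀ ≤ n → s * K ≤ m → m + s * K ≤ n → ∀ α β : Fin s → Fin n → ZMod 5, (∀ g : Fin (n + 1), g.val ≤ m → ∃ f : (Fin n → Bool) → Bool, ∃ R : (Fin n → Bool) → Finset (ZMod 5), ∃ φ : Fin n → ZMod 5, (φ = 0 ∨ ∃ k, φ = β k) ∧ ∀ u : Fin n → Bool, y g u = Bool.xor (f (fun i => decide (i.val < m) && u i)) (decide ((∑ i : Fin n, if m ≤ i.val ∧ u i = true then φ i else 0)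 ∈ R (fun i => decide (i.val < m) && u i)))) → (∀ g : Fin (n + 1), m < g.val → ∃ f : (Fin n → Bool) → Bool, ∃ R : (Fin n → Bool) → Finset (ZMod 5), ∃ φ : Fin n → ZMod 5, (φ = 0 ∨ ∃ k, φ = α k) ∧ ∀ u : Fin n → Bool, y g u = Bool.xor (f (fun i => decide (m ≤ i.val) && u i)) (decide ((∑ i : Fin n, if i.val < m ∧ u i = true then φ i else 0) ∈ R (fun i => decide (m ≤ i.val) && u i)))) → ((Finset.univ.filter fun u : Fin n → Bool => Summit.QuantumAdvantage.AdviceFreeQNC0.ringWinU c y u = true).card : ℝ) ≤ θ * (2 : ℝ) ^ n :=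
  Summit.QuantumAdvantage.AdviceFreeQNC0.OddConfig.fewFormsPairLaw_card

end Summit.QuantumAdvantage.QuantumAdvantage.Theorems
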